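import Literature.IUT.HodgeArakelov.TemperedCurveXu
import Literature.IUT.HodgeArakelov.StableCurveAgreementOfSpecialFibre
import HarnessLib

/-!
# [IUTchII] Def 2.3 (i) / B15: the genuine-to-genuine agreement at `v ∈ 𝕍^bad`, `GroupLevelData` form (no openness binder)

S. Mochizuki, *Inter-universal Teichmüller Theory II*, kurims manuscript (Dec. 2020), §2, Def 2.3 (i) p. 67; *Inter-universal Teichmüller
Theory I* (May 2020), §2 pp. 46–47, Def 3.1 (e) p. 62 [cite: Mochizuki2012, II Def 2.3 (i) p.67; I Def 3.1 (e) p.62]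
[cite: MochizukiSemiAnbd2006, §6 pp.69–71].  abc-iut cell, MERGE-MAP row **B15** (holder of piece 3: abc-iut-w5-d132 gen 4).  PROOF-ONLY
corollary of `StableCurveAgreementOfSpecialFibre.lean` (p433029) at abc-iut-L6-t7's `ThetaSetting.temperedCurveXuOfLevelData` /
`groupLevelDataXu` (B15 pieces 1b/1d): the tempered curve `X̲_v` WITH its induced `GroupLevelData`, whose openness input `hDopen` is
discharged from the compactness of the decomposition groups (piece 1c) — so the only binders left are the tower's printed inputs (`hZ`, `hN`),
the `GroupLevelData` `d` of `X_v` itself, and the special-fibre DATA of `X̲_v`.  Nothing of the series is asserted; no side taken on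
[IUTchIII] Cor 3.12.
-/

noncomputable section

namespace Literature.IUT.HodgeArakelov

open Literature.AnabelianGeometry.EtaleTheta Literature.AnabelianGeometry.SemiGraphs Literature.IUT.HodgeTheaters
open scoped Pointwise

namespace PlusMinusTower

variable {p : ℕ} [Fact p.Prime] {M : MuTwoSetting p} (e : M.CLevelData)
  {E : M.toThetaSetting.EtaleThetaData} {l : ℕ} (C : E.DoubleUnderline l) {N : ℕ+}
  (μ : M.toThetaSetting.CyclotomeMod l N) (hC : M.toThetaSetting.Compat) (hS : M.toThetaSetting.Sec2Hyps)
  (hl : l.Prime) (hp2 : p ≠ 2) (hpl : p ≠ l) (hζ : ∃ ζ : M.toThetaSetting.K, IsPrimitiveRoot ζ (4 * l))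
  {η : (C.thetaEnvData μ hC hS).PiYdd → MuN p N} (hη : η ∈ (C.thetaEnvData μ hC hS).thetaCocycles)
  (hZ : Thm16Sub.KerToZIsCompactlyGenerated M.toThetaSetting) (hN : (C.Huu.subgroupOf (M.GtpXu l)).Normal)
  {P : TopGroup.{0}} (T : TemperedCoverings (BadPlaceSetting.ofUnderline C μ hC hS hl hp2 hpl hζ hη) P)

/-- **B15, `GroupLevelData` form (no `hDopen` binder)**: the AGREEMENT between the genuine tower `ofPiCHat` and abc-iut-L5's genuine [IUTchI] §2
datum of abc-iut-L6-t7's `X̲_v := temperedCurveXuOfLevelData l _ d` (the covering `X̲_v → X_v` WITH its induced `GroupLevelData`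
`groupLevelDataXu`; the openness input `hDopen` is discharged there from the compactness of the `D_x`, which `d` provides), for ANY
special-fibre data `Sf` of `X̲_v`.  Corollary of `exists_stableCurveAgreement_ofPiCHat_ofSpecialFibre` (p433029) by definitional
unfolding (the remaining discrepancies are proofs of Props).  ([IUTchII] Def 2.3 (i), kurims p.67; [IUTchI] Def 3.1 (e) p.62)
[claim: Mochizuki2012, status: disputed] -/
theorem exists_stableCurveAgreement_ofPiCHat_ofSpecialFibreXu (d : M.toTemperedCurve.GroupLevelData)
    (Sf : SpecialFibreData ((M.toThetaSetting.temperedCurveXuOfLevelData l C.l_ne_zero d).toTemperedArithmeticGroup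
      (M.toThetaSetting.groupLevelDataXu l C.l_ne_zero d)))
    (h36 : Sf.Gc.Prop36Hypotheses) (Sigma SigmaHat : Set ℕ) (hsub : Sigma ⊆ SigmaHat) (hne : Sigma.Nonempty)
    (hprime : ∀ q ∈ SigmaHat, q.Prime) (hp : p ∉ Sigma) (TpH : Subgroup Sf.chart.G)
    (HatH : Subgroup (TemperedGraphGroupData.exists_completion_of_prop36 Sf.Gc h36 Sf.chart).choose)
    (hle : TpH.map (TemperedGraphGroupData.exists_completion_of_prop36 Sf.Gc h36 Sf.chart).choose_spec.choose.toMonoidHom ≤ HatH)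
    (cuspMeetsH : {x : (M.toThetaSetting.temperedCurveXuOfLevelData l C.l_ne_zero d).Pt //
      (M.toThetaSetting.temperedCurveXuOfLevelData l C.l_ne_zero d).IsCusp x} → Prop) :
    ∃ (Cu : CuspidalInertiaData (ofPiCHat e C μ hC hS hl hp2 hpl hζ hη hZ hN T))
      (A : StableCurveAgreement (ofPiCHat e C μ hC hS hl hp2 hpl hζ hη hZ hN T) Cu
        (StableCurveTemperedData.ofSpecialFibre (M.toThetaSetting.temperedCurveXuOfLevelData l C.l_ne_zero d)
          (M.toThetaSetting.groupLevelDataXu l C.l_ne_zero d) Sf h36 Sigma SigmaHat hsub hne hprime hp TpH HatH hle cuspMeetsH)),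
      (∀ x : T.Xplain,
        A.eHat ⟨(ofPiCHat e C μ hC hS hl hp2 hpl hζ hη hZ hN T).emb x,
            (ofPiCHat e C μ hC hS hl hp2 hpl hζ hη hZ hN T).emb_le_pmHat ⟨x, rfl⟩⟩ =
          (StableCurveTemperedData.ofSpecialFibre (M.toThetaSetting.temperedCurveXuOfLevelData l C.l_ne_zero d)
            (M.toThetaSetting.groupLevelDataXu l C.l_ne_zero d) Sf h36 Sigma SigmaHat hsub hne hprime hp TpH HatH hle
            cuspMeetsH).ιX (T.plainIso x)) ∧
      (∀ (Q I : Subgroup (ofPiCHat e C μ hC hS hl hp2 hpl hζ hη hZ hN T).Corhat), Cu.IsCuspidalInertia Q I ↔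
        I ≤ Q ∧ ∃ I₀, Cu.IsCuspidalInertia (ofPiCHat e C μ hC hS hl hp2 hpl hζ hη hZ hN T).piPM I₀ ∧ I = I₀ ⊓ Q) := by
  haveI : (M.GtpXu l).FiniteIndex := finiteIndex_GtpXu_of_doubleUnderline C
  haveI : FiniteDimensional ℚ_[p] M.K := M.finiteDimensional_K
  exact exists_stableCurveAgreement_ofPiCHat_ofSpecialFibre e C μ hC hS hl hp2 hpl hζ hη hZ hN T
    (M.toTemperedCurve.hDopen_of_isCompact_decomp (M.GtpXu l) (M.toThetaSetting.isOpen_GtpXu l)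
      (M.toTemperedCurve.decompCompact_of_groupLevelData d))
    (M.toThetaSetting.groupLevelDataXu l C.l_ne_zero d) Sf h36 Sigma SigmaHat hsub hne hprime hp TpH HatH hle cuspMeetsH

end PlusMinusTower

end Literature.IUT.HodgeArakelov

end
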